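import Literature.Computability.QuantumComplexity.OracleSubstitution
import Literature.Computability.QuantumComplexity.TidyBlock
import Literature.Computability.Cryptography.ClassBQP
import HarnessLib

/-!
# `BQP` subroutines inside bounded-error quantum search: the assembly of `BQP^BQP = BQP`

Topic `Literature/Computability/QuantumComplexity`; third file of the discharge of the named fact
`Literature.Computability.Cryptography.isQSolvable_of_mem_BQP_oracle` (`Cryptography/ShorAssembly.lean`):
Bennett–Bernstein–Brassard–Vazirani 1997, §4.2, **Thm. 4.13** (boosting: "`k = b log 1/ε`
independent copies … take the majority"), **Thm. 4.14** (tidy machines: run, copy the answer,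
reverse) and **Cor. 4.15** (`BQP^BQP = BQP`, stated without proof: replace each oracle call by a
tidy machine). With the two proved companion files — `OracleSubstitution.lean` (the substitution of
blocks for the oracle gates of a family and its output distribution, Cor. 4.15) and `TidyBlock.lean`
(compute–copy–uncompute around a decider, Thm. 4.14) — this file

* fixes the two-parameter vocabulary of BBBV's subroutines in circuit form: **decider families**
  `DeciderFamily` (for query length `k` and precision parameter `r`, an oracle-free circuit on
  `k + anc k r` wires deciding `[q ∈ A]` on wire `0` with error `ε r` on every *classical* query —
  `DeciderFamily.Decides`, in terms of the tree's `QCircuit.acceptProb`), **tidy families**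
  `TidyFamily` (blocks on `(k + 1) + anc k r` wires implementing the query gate up to `ε r`,
  `TidyFamily.Implements`, i.e. `OracleImpl.Implements` at every precision), and their
  poly-time uniformity in the pair of *unary* parameters `⟨1^k, 1^r⟩` (`DeciderFamily.IsUniform`,
  `TidyFamily.IsUniform`; unary `r` makes "polynomial in `r`" the circuit-size reading of BBBV's
  "polynomial in `log 1/ε`" for `ε = 2^{-r}` and a relaxation of it for `ε = 1/poly(r)`);
* PROVES `DeciderFamily.tidy_implements`: the tidy family of a decider family with error
  `≤ 1/(r+1)²` implements the oracle up to `2/(r+1)` (from `TidyBlock.tidyCirc_implOn` and the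
  bridge `TidyBlock.errProb_le_of_acceptProb` between the Born weight of the wrong answers and the
  acceptance probability);
* does NOT vendor the three remaining ingredients as named facts (D-0026: they are to be proved
  in sequel files); they appear here only as explicitly quantified HYPOTHESES of the assembly:
  (i) boosting, Thm. 4.13 in circuit form — uniform decider families of inverse-polynomial
  precision for `A ∈ BQP` (repetition on disjoint wires, reversible majority, Chebyshev, and the
  uniformity of that construction); (ii) the tidy family of a uniform decider family is uniform
  (the time bound of Thm. 4.14; a programming fact about descriptions); (iii) the substituted
  family of `OracleSubstitution.lean` is uniform when the given family and the blocks are and the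
  precision schedule is a polynomial (the running-time half of Cor. 4.15; a programming fact);
* PROVES the assembly `isQSolvable_of_tidyFamily`: from a tidy family implementing `A` up to
  `C/(r+1)` whose substituted families are uniform, and a family `F` with oracle gates for `A`
  solving an extension-closed relation `R` with probability `≥ 2/3 + δ`, one gets `IsQSolvable R`:
  choose the precision schedule `q = c₀ · p` with `p` the size polynomial of `F`
  (`IsUniform.isPolySize'`) and `c₀ ≥ C/δ`, so that the `≤ p(n)` replaced gates cost at most `δ`
  (`OracleImpl.kernelProb_substFamily_ge`), the fresh wires reading `0` in the ideal run being
  absorbed by the extension-closedness of `R`.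

The final implication "(i) ∧ (ii) ∧ (iii) → `isQSolvable_of_mem_BQP_oracle`" is recorded next to
the fact, in `Cryptography/ShorAssemblyProofs.lean`.

## References

* C. H. Bennett, E. Bernstein, G. Brassard, U. Vazirani, *Strengths and weaknesses of quantum
  computing*, SIAM J. Comput. 26 (1997) 1510–1523 = arXiv:quant-ph/9701001 (held; pp. 11–13):
  §4.2, Thm. 4.13, Thm. 4.14, Cor. 4.15 [BennettBernsteinBrassardVazirani1997].
* E. Bernstein, U. Vazirani, *Quantum complexity theory*, SIAM J. Comput. 26 (1997), §8
  (`BQP^BQP = BQP` for oracle QTMs; uniform circuit descriptions) [BernsteinVazirani1997].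
* S. Arora, B. Barak, *Computational Complexity: A Modern Approach*, CUP 2009, §6.2 and
  Remark 6.7 (P-uniform families: the description is printed in polynomial time)
  [AroraBarak2009].
-/

noncomputable section

namespace Literature.Computability.QuantumComplexity

open Cryptography Matrix _root_.Computability Complexity

variable {G : QGateSet}

/-! ### Two-parameter families and their uniformity -/

/-- The encoding of the two unary parameters `(k, r)` of a subroutine family: `⟨1^k, 1^r⟩`
(`boolPair` of the unary numerals). [folklore] -/
def unaryPairEncode (p : ℕ × ℕ) : List Bool :=
  boolPair (unaryEncodeNat p.1) (unaryEncodeNat p.2)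

/-- **Decider families**: for every query length `k` and precision parameter `r`, a circuit on
`k + anc k r` wires, to be run on `|q⟩|0^{anc k r}⟩` and measured on wire `0` (BBBV's boosted
machine `M'` of Thm. 4.13, in circuit form and for all input lengths at once).
[cite: BennettBernsteinBrassardVazirani1997, Thm. 4.13] -/
structure DeciderFamily (G : QGateSet) where
  /-- the number of ancillas for query length `k` and precision `r` -/
  anc : ℕ → ℕ → ℕ
  /-- the decider for query length `k` and precision `r` -/
  circ : (k r : ℕ) → QCircuit G (k + anc k r)

/-- **Tidy families**: for every query length `k` and precision parameter `r`, a block on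
`(k + 1) + anc k r` wires meant to implement the XOR query gate on its first `k + 1` wires with
the ancillas returned to `0` (BBBV's tidy machine of Thm. 4.14, in circuit form).
[cite: BennettBernsteinBrassardVazirani1997, Thm. 4.14] -/
structure TidyFamily (G : QGateSet) where
  /-- the number of ancillas for query length `k` and precision `r` -/
  anc : ℕ → ℕ → ℕ
  /-- the block for query length `k` and precision `r` -/
  circ : (k r : ℕ) → QCircuit G (k + 1 + anc k r)

namespace DeciderFamily

/-- All the deciders are oracle-free. [folklore] -/
def IsOracleFree (D : DeciderFamily G) : Prop := ∀ k r, (D.circ k r).IsOracleFree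

/-- **Poly-time uniformity in `⟨1^k, 1^r⟩`**: the description `sigmaEncode ⟨k, anc k r, circ k r⟩`
is printed in time polynomial in `k + r`. [cite: AroraBarak2009, §6.2 Remark 6.7] -/
def IsUniform [Encodable G.Op] (D : DeciderFamily G) : Prop :=
  PolyTimeComputable unaryPairEncode (QCircuit.sigmaEncode (G := G))
    fun p : ℕ × ℕ => (⟨p.1, D.anc p.1 p.2, D.circ p.1 p.2⟩ : Σ n m : ℕ, QCircuit G (n + m))

/-- **`D` decides `A` with error `ε r`**: on every classical query `q ∈ {0,1}^k`, the decider of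
precision `r`, run on `|q⟩|0…0⟩` and measured on wire `0`, answers `[q ∈ A]` except with
probability at most `ε r` ("accepts with probability `1 − ε`", BBBV Def. 4.12 / Thm. 4.13).
[cite: BennettBernsteinBrassardVazirani1997, Def. 4.12 and Thm. 4.13] -/
def Decides (D : DeciderFamily G) (A : Language Bool) (ε : ℕ → ℝ) : Prop :=
  ∀ k r (q : QReg k), (List.ofFn q ∈ A → 1 - ε r ≤ (D.circ k r).acceptProb 0 q) ∧
    (List.ofFn q ∉ A → (D.circ k r).acceptProb 0 q ≤ ε r)

/-- **The tidy family of a decider family**: compute–copy–uncompute around each decider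
(`TidyBlock.tidyCirc`: copy the query, run the decider on the copy, copy its answer onto the
answer wire, run the inverse decider, uncopy). [cite: BennettBernsteinBrassardVazirani1997, Thm. 4.14 (proof)] -/
def tidy (D : DeciderFamily cliffordT) : TidyFamily cliffordT where
  anc k r := k + D.anc k r
  circ k r := TidyBlock.tidyCirc (D.circ k r)

end DeciderFamily

namespace TidyFamily

/-- The blocks of a fixed precision `r`, as an `OracleImpl`. [folklore] -/
def fix (S : TidyFamily G) (r : ℕ) : OracleImpl G where
  anc k := S.anc k r
  circ k := S.circ k r

/-- **Poly-time uniformity in `⟨1^k, 1^r⟩`**: the description `sigmaEncode ⟨k + 1, anc k r,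
circ k r⟩` is printed in time polynomial in `k + r`. [cite: AroraBarak2009, §6.2 Remark 6.7] -/
def IsUniform [Encodable G.Op] (S : TidyFamily G) : Prop :=
  PolyTimeComputable unaryPairEncode (QCircuit.sigmaEncode (G := G))
    fun p : ℕ × ℕ => (⟨p.1 + 1, S.anc p.1 p.2, S.circ p.1 p.2⟩ : Σ n m : ℕ, QCircuit G (n + m))

/-- **`S` implements the oracle `A` up to `ε r`** at every precision `r` (`OracleImpl.Implements`:
oracle-free blocks within `ε r`, in the `ImplOn` sense, of the query gate on clean inputs).
[cite: BennettBernsteinBrassardVazirani1997, Thm. 4.14] -/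
def Implements (S : TidyFamily G) (A : Language Bool) (ε : ℕ → ℝ) : Prop :=
  ∀ r, (S.fix r).Implements A (ε r)

end TidyFamily

/-! ### From deciders to tidy blocks (proved) -/

namespace TidyBlock

variable {k d : ℕ}

/-- The acceptance probability of a decider on a classical query as a Born sum over the answer
bit `ans` of `TidyBlock.lean`. [folklore] -/
theorem acceptProb_eq_sum_ans (D : QCircuit cliffordT (k + d)) (q : QReg k) :
    D.acceptProb 0 q = ∑ f, if ans f = true then ‖ψD D q f‖ ^ 2 else 0 := by
  unfold QCircuit.acceptProb ans ψD
  refine Finset.sum_congr rfl fun f _ => ?_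
  by_cases h : 0 < k + d
  · simp only [h, dif_pos]
    rfl
  · simp [h]

/-- **Bridge**: a decider answering `[q ∈ A]` except with probability `ε` (in the acceptance
sense) errs with Born weight at most `ε` (in the sense of `TidyBlock.errProb`). [folklore] -/
theorem errProb_le_of_acceptProb (A : Language Bool) (D : QCircuit cliffordT (k + d)) (q : QReg k) {ε : ℝ}
    (hyes : List.ofFn q ∈ A → 1 - ε ≤ D.acceptProb 0 q) (hno : List.ofFn q ∉ A → D.acceptProb 0 q ≤ ε) :
    errProb A D q ≤ ε := by
  have htot : ∑ f, ‖ψD D q f‖ ^ 2 = 1 :=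
    QCircuit.normSq_runOn_basisState cliffordT_isUnitary_holds 0 D q
  have hsplit : ∑ f, ‖ψD D q f‖ ^ 2 =
      (∑ f, if ans f = true then ‖ψD D q f‖ ^ 2 else 0) + ∑ f, if ans f = false then ‖ψD D q f‖ ^ 2 else 0 := by
    rw [← Finset.sum_add_distrib]
    exact Finset.sum_congr rfl fun f _ => by cases ans f <;> simp
  rw [errProb_eq_sum]
  by_cases hq : List.ofFn q ∈ A
  · have ha : abit A q = true := (Set.mem_iff_boolIndicator _ _).1 hq
    have h1 := hyes hq
    rw [acceptProb_eq_sum_ans] at h1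
    simp only [ha, Bool.not_true]
    linarith
  · have ha : abit A q = false := (Set.notMem_iff_boolIndicator _ _).1 hq
    have h1 := hno hq
    rw [acceptProb_eq_sum_ans] at h1
    simpa only [ha, Bool.not_false] using h1

end TidyBlock

/-- **The tidy family of a good decider family implements the oracle** (BBBV Thm. 4.14 in the
tree's model, proved): deciders that are right except with probability `1/(r+1)²` on every
classical query give tidy blocks within `2/(r+1)` of the query gate on clean inputs.
[cite: BennettBernsteinBrassardVazirani1997, Thm. 4.14] -/
theorem DeciderFamily.tidy_implements {D : DeciderFamily cliffordT} {A : Language Bool}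
    (hfree : D.IsOracleFree) (hdec : D.Decides A fun r => 1 / ((r : ℝ) + 1) ^ 2) :
    D.tidy.Implements A fun r => 2 / ((r : ℝ) + 1) := by
  intro r
  refine ⟨fun k => TidyBlock.tidyCirc_isOracleFree (hfree k r), fun k => ?_⟩
  have hr : (0 : ℝ) < (r : ℝ) + 1 := by positivity
  have h := TidyBlock.tidyCirc_implOn A (D.circ k r) (ε := 1 / ((r : ℝ) + 1) ^ 2) (by positivity)
    fun q => TidyBlock.errProb_le_of_acceptProb A (D.circ k r) q (hdec k r q).1 (hdec k r q).2
  have e : 2 * Real.sqrt (1 / ((r : ℝ) + 1) ^ 2) = 2 / ((r : ℝ) + 1) := by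
    rw [Real.sqrt_div' _ (sq_nonneg _), Real.sqrt_one, Real.sqrt_sq hr.le]
    ring
  rw [e] at h
  exact h

/-! ### The assembly (proved) -/

/-- `numOracle` of a circuit is at most its size. [folklore] -/
theorem numOracle_le_size {N : ℕ} (C : QCircuit G N) : OracleImpl.numOracle C.gates ≤ C.size :=
  OracleImpl.numOracle_le_length C.gates

/-- **`BQP^BQP = BQP`, search form, from a tidy family** (Bennett–Bernstein–Brassard–Vazirani
1997, Cor. 4.15, assembled in the tree's model): if the blocks `S` implement `A` up to `C/(r+1)`,
every substituted family `substFamily F (S.fix ∘ q.eval)` with a polynomial precision schedule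
`q` is uniform (the running-time half of Cor. 4.15, an explicit hypothesis here), and the uniform
family `F` with oracle gates for `A` outputs a string in the extension-closed relation `R x` with
probability `≥ 2/3 + δ`, then `R` is solvable in bounded-error quantum polynomial time:
substitute the blocks of precision `q(n) = c₀ · p(n)`, `p` the size polynomial of `F` and
`c₀ ≥ C/δ`, for the `≤ p(n)` oracle gates of `F.circ n` (total deviation `≤ δ`,
`OracleImpl.kernelProb_substFamily_ge`); the fresh wires read `0` in the ideal run and `R x` is
closed under appending them. [cite: BennettBernsteinBrassardVazirani1997, Cor. 4.15 (BQP^BQP = BQP)] -/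
theorem isQSolvable_of_tidyFamily {A : Language Bool}
    {R : List Bool → Set (List Bool)} {F : QCircuitFamily cliffordT} {δ : ℝ}
    (S : TidyFamily cliffordT) (C : ℝ) (hC : 0 ≤ C)
    (hunif : ∀ q : Polynomial ℕ, (OracleImpl.substFamily F fun n => S.fix (q.eval n)).IsUniform)
    (himp : S.Implements A fun r => C / ((r : ℝ) + 1))
    (hR : ∀ x, ∀ y ∈ R x, ∀ z, y <+: z → z ∈ R x) (hF : F.IsUniform) (hδ : 0 < δ)
    (hk : ∀ x, 2 / 3 + δ ≤ F.kernelProb A x (R x)) : IsQSolvable R := by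
  -- the size polynomial and the precision schedule
  obtain ⟨p, hp⟩ := QCircuitFamily.IsUniform.isPolySize' hF
  obtain ⟨c₀, hc₀⟩ := exists_nat_ge (C / δ)
  let q : Polynomial ℕ := Polynomial.C c₀ * p
  have hq : ∀ n, q.eval n = c₀ * p.eval n := fun n => by simp [q]
  let B : ℕ → OracleImpl cliffordT := fun n => S.fix (q.eval n)
  let ε : ℕ → ℝ := fun n => C / (((q.eval n : ℕ) : ℝ) + 1)
  have hε : ∀ n, 0 ≤ ε n := fun n => by positivity
  have hB : ∀ n, (B n).Implements A (ε n) := fun n => himp (q.eval n)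
  refine ⟨OracleImpl.substFamily F B, OracleImpl.substFamily_isOracleFree F B fun n k => (hB n).isOracleFree k,
    hunif q, fun x => ?_⟩
  have hmain := OracleImpl.kernelProb_substFamily_ge F B A ε hε hB x (R x)
  -- the event with the fresh wires appended contains `R x`
  have hsub : R x ⊆ {y | y ++ List.replicate (OracleImpl.extra (B x.length) (F.circ x.length).gates) false ∈ R x} :=
    fun y hy => hR x y hy _ (List.prefix_append _ _)
  have hmono := F.kernelProb_mono A x hsub
  -- the cost of the replaced gates
  set P : ℝ := ((p.eval x.length : ℕ) : ℝ) with hPdef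
  set Q : ℝ := ((q.eval x.length : ℕ) : ℝ) with hQdef
  have hT : (OracleImpl.numOracle (F.circ x.length).gates : ℝ) ≤ P := by
    rw [hPdef]
    exact_mod_cast (numOracle_le_size (F.circ x.length)).trans (hp x.length).1
  have hcost : (OracleImpl.numOracle (F.circ x.length).gates : ℝ) * ε x.length ≤ δ := by
    have hP : (0 : ℝ) ≤ P := Nat.cast_nonneg _
    have hCδ : C ≤ δ * c₀ := by
      have := (div_le_iff₀ hδ).1 hc₀
      linarith [this]
    have hden : (0 : ℝ) < Q + 1 := by positivity
    have hq' : Q = (c₀ : ℝ) * P := by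
      rw [hQdef, hPdef, hq]; push_cast; ring
    have hεx : ε x.length = C / (Q + 1) := rfl
    calc (OracleImpl.numOracle (F.circ x.length).gates : ℝ) * ε x.length
        ≤ P * ε x.length := mul_le_mul_of_nonneg_right hT (hε _)
      _ = P * C / (Q + 1) := by rw [hεx]; ring
      _ ≤ δ := by
        rw [div_le_iff₀ hden, hq']
        have h1 : P * C ≤ P * (δ * c₀) := mul_le_mul_of_nonneg_left hCδ hP
        nlinarith [h1, hP, hδ]
  have := hk x
  linarith

end Literature.Computability.QuantumComplexity

end
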